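import Mathlib
import Summits.NavierStokesRegularity.NavierStokesRegularity.Theorems.EulerZoomLiouvillePowerGaugeEulerLiouvilleSelfSimilarBernoulliThinness
import Summits.NavierStokesRegularity.NavierStokesRegularity.Theorems.EulerZoomLiouvillePowerGaugeEulerLiouvilleNeedleThinCore
import Summits.NavierStokesRegularity.NavierStokesRegularity.Theorems.EulerZoomLiouvillePowerGaugeEulerLiouvilleSelfSimilarBernoulliBounded
import HarnessLib.Audit

/-!
# Crux `EulerZoomLiouville.PowerGaugeEulerLiouville` (stmt-NavierStokesRegularity-19832), THE ONE STATEMENT `stub_selfSimilarC2Needle`: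
# THE FAST SET IS SOBOLEV-THIN — thinness rate `m = 3+3ρ` for the (C2) volume squeeze

Route №10 `EulerZoomLiouville` (NavierStokesRegularity), crux E = stmt-NavierStokesRegularity-19832; LEAD ns-typeII-p2 g11, own stub.  Brick for the
width seat ns-ezl-w5 g0's typed (C2) VOLUME SQUEEZE `…SelfSimilarBernoulliSqueeze` (p631796, `Loc.curl_eq_zero_of_fastChannel_of_thin`: thinness rate `m` of
the high sets a PARAMETER, race `3γ < c₁ m`).  The `A`-gauge alone makes the fast set `{‖V y‖ ≥ a‖y‖}` thin with rate `m = 1+2ρ` (Chebyshev in `L²`;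
ns-sz-p1 g4 `BernoulliThinness`, ezl-w5's member p632961), which asks the channel rate `c₁ > 3/((2+ρ)(1+2ρ))` (`= 0.6` at `ρ = ½`) — MORE than the
radial rate `≈ √(γ(1−γ)) ≈ 0.49` of a merely Bernoulli-high unpressurised channel.  HERE the `E`-gauge is spent instead: a class profile has
`∫_{B_L}‖∇V‖² ≤ c_E L^{1−ρ}` (`NeedleThinCore.selfSimilar_shell_inputs`), so the Gagliardo–Nirenberg–Sobolev inequality (`p = 2`, `p* = 6`; Mathlib's
`eLpNorm_le_eLpNorm_fderiv_of_eq_inner` applied to a cut-off copy `χ_L • V`) gives `∫_{‖y‖≤2L}‖V‖⁶ ≲ L^{3(1−ρ)}` and Chebyshev in `L⁶`: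

> `vol({a‖y‖ ≤ ‖V y‖} ∩ {L ≤ ‖y‖ ≤ 2L}) ≤ K L^{−3−3ρ}` (`Loc.volume_fastSet_inter_shell_le_sobolev`),
> `vol({a‖y‖ ≤ ‖V y‖} ∩ {R ≤ ‖y‖}) ≤ K′ R^{−3−3ρ}` (`Loc.volume_fastSet_inter_far_le_sobolev`; generic dyadic tail `Loc.volume_inter_far_le_of_shell`).

So the squeeze's race becomes `3γ < c₁(3+3ρ)`, i.e. `c₁ > γ/(1+ρ) = 1/((2+ρ)(1+ρ))` (`= 4/15 ≈ 0.27` at `ρ = ½`); since `√(γ(1−γ))·(2+ρ)(1+ρ) = (1+ρ)^{3/2} > 1`,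
an unpressurised RADIAL Bernoulli-high channel always loses it.  The member-level corollary (ezl-w5's `Loc.selfSimilar_ae_eq_zero_of_fastChannelC2_profile`
with the threshold lowered to `1/((2+ρ)(1+ρ))`) is the next LEAD's / ezl-w5's to assemble from this brick.  WHAT THIS IS NOT: not NS, not E — a brick for one
dynamical sub-stratum of THE ONE STATEMENT; 19832 is OPEN. [folklore; Gagliardo–Nirenberg–Sobolev inequality]
-/

noncomputable section

set_option linter.dupNamespace false

open MeasureTheory Set Filter Topology Metric Function InnerProductSpace Module
open scoped RealInnerProductSpace NNReal ENNReal ContDiff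

namespace Summit.NavierStokesRegularity.NavierStokesRegularity.Theorems.PowerGaugeEulerLiouville.Loc

open Literature.Analysis Literature.Analysis.FluidPDE

/-! ### A scaled cutoff with gradient `O(1/L)` -/

/-- **Scaled radial cutoffs.**  There is `M ≥ 0` such that for every `L > 0` there is a `C¹` compactly supported `χ : ℝ³ → [0,1]` with `χ = 1` on
`‖y‖ ≤ 2L`, `χ = 0` (indeed `χ ≡ 0` near every point) where `‖y‖ > 4L`, and `‖∇χ‖ ≤ M/L` everywhere (`χ(y) = σ(y/(2L))` for the tree's radial cutoff
`σ`, `exists_radialCutoff`). [folklore] -/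
theorem exists_scaledCutoff :
    ∃ M : ℝ, 0 ≤ M ∧ ∀ L : ℝ, 0 < L →
      ∃ χ : EuclideanSpace ℝ (Fin 3) → ℝ, ContDiff ℝ 1 χ ∧ HasCompactSupport χ ∧
        (∀ y, 0 ≤ χ y) ∧ (∀ y, χ y ≤ 1) ∧ (∀ y, ‖y‖ ≤ 2 * L → χ y = 1) ∧
        (∀ y, 4 * L < ‖y‖ → χ =ᶠ[𝓝 y] fun _ => 0) ∧ (∀ y, ‖fderiv ℝ χ y‖ ≤ M / L) := by
  obtain ⟨σ, hσs, hσc, h0, h1, hone, hzero, -⟩ := exists_radialCutoff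
  have hσ1 : ContDiff ℝ 1 σ := hσs.of_le (by exact_mod_cast le_top)
  have hdc : Continuous (fderiv ℝ σ) := hσ1.continuous_fderiv one_ne_zero
  obtain ⟨M, hM⟩ := hdc.bounded_above_of_compact_support (hσc.fderiv ℝ)
  have hM0 : 0 ≤ M := (norm_nonneg _).trans (hM 0)
  refine ⟨M, hM0, fun L hL => ?_⟩
  have h2L : (0 : ℝ) < 2 * L := by positivity
  set c : ℝ := (2 * L)⁻¹ with hc
  have hc0 : 0 < c := inv_pos.2 h2L
  set χ : EuclideanSpace ℝ (Fin 3) → ℝ := fun y => σ (c • y) with hχ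
  have hsm : ContDiff ℝ 1 (fun y : EuclideanSpace ℝ (Fin 3) => c • y) := contDiff_const_smul c
  have hχ1 : ContDiff ℝ 1 χ := hσ1.comp hsm
  have hχc : HasCompactSupport χ := hσc.comp_smul hc0.ne'
  refine ⟨χ, hχ1, hχc, fun y => h0 _, fun y => h1 _, fun y hy => ?_, fun y hy => ?_, fun y => ?_⟩
  · -- `χ = 1` on `‖y‖ ≤ 2L`
    apply hone
    rw [norm_smul, Real.norm_of_nonneg hc0.le, hc, inv_mul_le_iff₀ h2L]
    simpa using hy
  · -- `χ ≡ 0` near a point with `‖y‖ > 4L`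
    have hopen : IsOpen {z : EuclideanSpace ℝ (Fin 3) | 4 * L < ‖z‖} := isOpen_lt continuous_const continuous_norm
    filter_upwards [hopen.mem_nhds hy] with z hz
    apply hzero
    rw [norm_smul, Real.norm_of_nonneg hc0.le, hc, le_inv_mul_iff₀ h2L]
    linarith
  · -- the gradient bound
    have hd : HasFDerivAt χ ((fderiv ℝ σ (c • y)).comp (c • ContinuousLinearMap.id ℝ (EuclideanSpace ℝ (Fin 3)))) y := by
      have h1 : HasFDerivAt (fun y : EuclideanSpace ℝ (Fin 3) => c • y)
          (c • ContinuousLinearMap.id ℝ (EuclideanSpace ℝ (Fin 3))) y := (hasFDerivAt_id y).const_smul c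
      exact ((hσ1.differentiable one_ne_zero) (c • y)).hasFDerivAt.comp y h1
    rw [hd.fderiv]
    calc ‖(fderiv ℝ σ (c • y)).comp (c • ContinuousLinearMap.id ℝ (EuclideanSpace ℝ (Fin 3)))‖
        ≤ ‖fderiv ℝ σ (c • y)‖ * ‖c • ContinuousLinearMap.id ℝ (EuclideanSpace ℝ (Fin 3))‖ :=
          ContinuousLinearMap.opNorm_comp_le _ _
      _ ≤ M * c := by
          refine mul_le_mul (hM _) ?_ (norm_nonneg _) hM0
          rw [norm_smul, Real.norm_of_nonneg hc0.le]
          exact mul_le_of_le_one_right hc0.le ContinuousLinearMap.norm_id_le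
      _ ≤ M / L := by
          rw [hc, div_eq_mul_inv]
          exact mul_le_mul_of_nonneg_left (inv_anti₀ hL (by linarith)) hM0


/-! ### Gagliardo–Nirenberg–Sobolev on a cut-off copy of the profile -/

/-- **`L⁶` mass of the profile on `‖y‖ ≤ 2L` from the gradient energy and the mass on `B_{5L}`** (Gagliardo–Nirenberg–Sobolev, `p = 2`, `p* = 6`,
for the compactly supported `C¹` field `χ • V`, `χ` a cutoff as in `exists_scaledCutoff` with `‖∇χ‖ ≤ B`):
`∫_{‖y‖≤2L} ‖V‖⁶ ≤ C_GNS⁶ · (2∫_{B_{5L}}‖∇V‖² + 2B²∫_{B_{5L}}|V|²)³`. [folklore; Gagliardo–Nirenberg–Sobolev inequality, Mathlib `eLpNorm_le_eLpNorm_fderiv_of_eq_inner`] -/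
theorem lintegral_norm_pow_six_le_of_cutoff {V : EuclideanSpace ℝ (Fin 3) → EuclideanSpace ℝ (Fin 3)} (hV : ContDiff ℝ 1 V)
    {χ : EuclideanSpace ℝ (Fin 3) → ℝ} (hχ1 : ContDiff ℝ 1 χ) (hχc : HasCompactSupport χ) (h1 : ∀ y, χ y ≤ 1) (h0 : ∀ y, 0 ≤ χ y)
    {L B : ℝ} (hL : 0 < L) (hone : ∀ y, ‖y‖ ≤ 2 * L → χ y = 1) (hzero : ∀ y, 4 * L < ‖y‖ → χ =ᶠ[𝓝 y] fun _ => 0)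
    (hB : ∀ y, ‖fderiv ℝ χ y‖ ≤ B) :
    ∫⁻ y in closedBall (0 : EuclideanSpace ℝ (Fin 3)) (2 * L), ‖V y‖ₑ ^ 6 ≤
      (eLpNormLESNormFDerivOfEqInnerConst (volume : Measure (EuclideanSpace ℝ (Fin 3))) 2 : ℝ≥0∞) ^ 6 *
        ((2 * ∫⁻ y in ball (0 : EuclideanSpace ℝ (Fin 3)) (5 * L), ‖fderiv ℝ V y‖ₑ ^ 2) +
          2 * ENNReal.ofReal (B ^ 2) * ∫⁻ y in ball (0 : EuclideanSpace ℝ (Fin 3)) (5 * L), ‖V y‖ₑ ^ 2) ^ 3 := by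
  set f : EuclideanSpace ℝ (Fin 3) → EuclideanSpace ℝ (Fin 3) := fun y => χ y • V y with hf
  have hf1 : ContDiff ℝ 1 f := hχ1.smul hV
  have hfc : HasCompactSupport f := hχc.smul_right
  -- ### GNS
  have hn : 0 < finrank ℝ (EuclideanSpace ℝ (Fin 3)) := by rw [finrank_euclideanSpace_fin]; norm_num
  have hp' : ((6 : ℝ≥0) : ℝ)⁻¹ = ((2 : ℝ≥0) : ℝ)⁻¹ - (finrank ℝ (EuclideanSpace ℝ (Fin 3)) : ℝ)⁻¹ := by
    rw [finrank_euclideanSpace_fin]; push_cast; norm_num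
  have hgns := eLpNorm_le_eLpNorm_fderiv_of_eq_inner (μ := (volume : Measure (EuclideanSpace ℝ (Fin 3))))
    hf1 hfc (p := 2) (p' := 6) (by norm_num) hn hp'
  have e6 : eLpNorm f ((6 : ℝ≥0) : ℝ≥0∞) volume = (∫⁻ y, ‖f y‖ₑ ^ 6) ^ (1 / 6 : ℝ) := by
    rw [ENNReal.coe_ofNat, eLpNorm_eq_lintegral_rpow_enorm_toReal (by norm_num) (by norm_num), ENNReal.toReal_ofNat]
    simp_rw [ENNReal.rpow_ofNat]
  have e2 : eLpNorm (fderiv ℝ f) ((2 : ℝ≥0) : ℝ≥0∞) volume = (∫⁻ y, ‖fderiv ℝ f y‖ₑ ^ 2) ^ (1 / 2 : ℝ) := by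
    rw [ENNReal.coe_ofNat, eLpNorm_eq_lintegral_rpow_enorm_toReal (by norm_num) (by norm_num), ENNReal.toReal_ofNat]
    simp_rw [ENNReal.rpow_ofNat]
  rw [e6, e2] at hgns
  have hgns6 := ENNReal.rpow_le_rpow hgns (by norm_num : (0 : ℝ) ≤ 6)
  rw [← ENNReal.rpow_mul, show (1 / 6 : ℝ) * 6 = 1 by norm_num, ENNReal.rpow_one,
    ENNReal.mul_rpow_of_nonneg _ _ (by norm_num : (0 : ℝ) ≤ 6), ← ENNReal.rpow_mul,
    show (1 / 2 : ℝ) * 6 = 3 by norm_num] at hgns6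
  -- `hgns6 : ∫⁻ ‖f‖ₑ^6 ≤ ↑C ^ (6:ℝ) * (∫⁻ ‖∇f‖ₑ^2) ^ (3:ℝ)`
  have hC : eLpNormLESNormFDerivOfEqInnerConst (volume : Measure (EuclideanSpace ℝ (Fin 3))) ((2 : ℝ≥0) : ℝ) =
      eLpNormLESNormFDerivOfEqInnerConst (volume : Measure (EuclideanSpace ℝ (Fin 3))) 2 := by
    rw [NNReal.coe_ofNat]
  rw [hC, ENNReal.rpow_ofNat _ 6, ENNReal.rpow_ofNat _ 3] at hgns6
  -- ### the left-hand side: `f = V` on `‖y‖ ≤ 2L`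
  have hlhs : ∫⁻ y in closedBall (0 : EuclideanSpace ℝ (Fin 3)) (2 * L), ‖V y‖ₑ ^ 6 ≤ ∫⁻ y, ‖f y‖ₑ ^ 6 := by
    calc ∫⁻ y in closedBall (0 : EuclideanSpace ℝ (Fin 3)) (2 * L), ‖V y‖ₑ ^ 6
        = ∫⁻ y in closedBall (0 : EuclideanSpace ℝ (Fin 3)) (2 * L), ‖f y‖ₑ ^ 6 := by
          refine setLIntegral_congr_fun measurableSet_closedBall (fun y hy => ?_)
          rw [mem_closedBall, dist_zero_right] at hy
          simp only [hf, hone y hy, one_smul]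
      _ ≤ ∫⁻ y, ‖f y‖ₑ ^ 6 := setLIntegral_le_lintegral _ _
  -- ### the right-hand side: pointwise gradient bound
  have hVd : Differentiable ℝ V := hV.differentiable one_ne_zero
  have hχd : Differentiable ℝ χ := hχ1.differentiable one_ne_zero
  have hpt : ∀ y, ‖fderiv ℝ f y‖ₑ ^ 2 ≤
      (ball (0 : EuclideanSpace ℝ (Fin 3)) (5 * L)).indicator
        (fun y => 2 * ‖fderiv ℝ V y‖ₑ ^ 2 + 2 * ENNReal.ofReal (B ^ 2) * ‖V y‖ₑ ^ 2) y := by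
    intro y
    by_cases hy : ‖y‖ ≤ 4 * L
    · have hyb : y ∈ ball (0 : EuclideanSpace ℝ (Fin 3)) (5 * L) := by
        rw [mem_ball, dist_zero_right]; linarith
      rw [indicator_of_mem hyb]
      have hdf : fderiv ℝ f y = χ y • fderiv ℝ V y + (fderiv ℝ χ y).smulRight (V y) :=
        fderiv_fun_smul (hχd y) (hVd y)
      have hnorm : ‖fderiv ℝ f y‖ ≤ ‖fderiv ℝ V y‖ + B * ‖V y‖ := by
        rw [hdf]
        refine (norm_add_le _ _).trans (add_le_add ?_ ?_)
        · rw [norm_smul, Real.norm_of_nonneg (h0 y)]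
          exact mul_le_of_le_one_left (norm_nonneg _) (h1 y)
        · rw [ContinuousLinearMap.norm_smulRight_apply]
          exact mul_le_mul_of_nonneg_right (hB y) (norm_nonneg _)
      have hsq : ‖fderiv ℝ f y‖ ^ 2 ≤ 2 * ‖fderiv ℝ V y‖ ^ 2 + 2 * B ^ 2 * ‖V y‖ ^ 2 := by
        calc ‖fderiv ℝ f y‖ ^ 2 ≤ (‖fderiv ℝ V y‖ + B * ‖V y‖) ^ 2 :=
              pow_le_pow_left₀ (norm_nonneg _) hnorm 2
          _ ≤ 2 * ‖fderiv ℝ V y‖ ^ 2 + 2 * (B * ‖V y‖) ^ 2 := by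
              nlinarith [sq_nonneg (‖fderiv ℝ V y‖ - B * ‖V y‖)]
          _ = 2 * ‖fderiv ℝ V y‖ ^ 2 + 2 * B ^ 2 * ‖V y‖ ^ 2 := by ring
      have e1 : ‖fderiv ℝ f y‖ₑ ^ 2 = ENNReal.ofReal (‖fderiv ℝ f y‖ ^ 2) := by
        rw [← ofReal_norm, ENNReal.ofReal_pow (norm_nonneg _)]
      have e2' : ‖fderiv ℝ V y‖ₑ ^ 2 = ENNReal.ofReal (‖fderiv ℝ V y‖ ^ 2) := by
        rw [← ofReal_norm, ENNReal.ofReal_pow (norm_nonneg _)]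
      have e3 : ‖V y‖ₑ ^ 2 = ENNReal.ofReal (‖V y‖ ^ 2) := by
        rw [← ofReal_norm, ENNReal.ofReal_pow (norm_nonneg _)]
      rw [e1, e2', e3]
      calc ENNReal.ofReal (‖fderiv ℝ f y‖ ^ 2)
          ≤ ENNReal.ofReal (2 * ‖fderiv ℝ V y‖ ^ 2 + 2 * B ^ 2 * ‖V y‖ ^ 2) := ENNReal.ofReal_le_ofReal hsq
        _ = 2 * ENNReal.ofReal (‖fderiv ℝ V y‖ ^ 2) + 2 * ENNReal.ofReal (B ^ 2) * ENNReal.ofReal (‖V y‖ ^ 2) := by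
          rw [ENNReal.ofReal_add (by positivity) (by positivity), ENNReal.ofReal_mul (by norm_num),
            ENNReal.ofReal_mul (by positivity), ENNReal.ofReal_mul (by norm_num), ENNReal.ofReal_ofNat]
    · -- beyond `4L` the field `f` vanishes near `y`
      have hfz : f =ᶠ[𝓝 y] fun _ => (0 : EuclideanSpace ℝ (Fin 3)) :=
        (hzero y (lt_of_not_ge hy)).mono fun z hz => by simp only [hf, hz, zero_smul]
      have h0' : fderiv ℝ f y = 0 := by rw [hfz.fderiv_eq]; simp
      rw [h0', ← ofReal_norm, norm_zero, ENNReal.ofReal_zero, zero_pow two_ne_zero]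
      exact zero_le
  have hmeasG : Measurable fun y => 2 * ‖fderiv ℝ V y‖ₑ ^ 2 :=
    ((hV.continuous_fderiv one_ne_zero).measurable.enorm.pow_const 2).const_mul 2
  have hrhs : ∫⁻ y, ‖fderiv ℝ f y‖ₑ ^ 2 ≤
      (2 * ∫⁻ y in ball (0 : EuclideanSpace ℝ (Fin 3)) (5 * L), ‖fderiv ℝ V y‖ₑ ^ 2) +
        2 * ENNReal.ofReal (B ^ 2) * ∫⁻ y in ball (0 : EuclideanSpace ℝ (Fin 3)) (5 * L), ‖V y‖ₑ ^ 2 := by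
    calc ∫⁻ y, ‖fderiv ℝ f y‖ₑ ^ 2
        ≤ ∫⁻ y, (ball (0 : EuclideanSpace ℝ (Fin 3)) (5 * L)).indicator
            (fun y => 2 * ‖fderiv ℝ V y‖ₑ ^ 2 + 2 * ENNReal.ofReal (B ^ 2) * ‖V y‖ₑ ^ 2) y := lintegral_mono hpt
      _ = ∫⁻ y in ball (0 : EuclideanSpace ℝ (Fin 3)) (5 * L),
            (2 * ‖fderiv ℝ V y‖ₑ ^ 2 + 2 * ENNReal.ofReal (B ^ 2) * ‖V y‖ₑ ^ 2) := lintegral_indicator measurableSet_ball _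
      _ = (2 * ∫⁻ y in ball (0 : EuclideanSpace ℝ (Fin 3)) (5 * L), ‖fderiv ℝ V y‖ₑ ^ 2) +
            2 * ENNReal.ofReal (B ^ 2) * ∫⁻ y in ball (0 : EuclideanSpace ℝ (Fin 3)) (5 * L), ‖V y‖ₑ ^ 2 := by
          rw [lintegral_add_left' hmeasG.aemeasurable]
          rw [lintegral_const_mul' _ _ ENNReal.ofNat_ne_top]
          rw [lintegral_const_mul' _ _ (ENNReal.mul_ne_top ENNReal.ofNat_ne_top ENNReal.ofReal_ne_top)]
  -- ### assemble
  calc ∫⁻ y in closedBall (0 : EuclideanSpace ℝ (Fin 3)) (2 * L), ‖V y‖ₑ ^ 6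
      ≤ ∫⁻ y, ‖f y‖ₑ ^ 6 := hlhs
    _ ≤ (eLpNormLESNormFDerivOfEqInnerConst (volume : Measure (EuclideanSpace ℝ (Fin 3))) 2 : ℝ≥0∞) ^ 6 * (∫⁻ y, ‖fderiv ℝ f y‖ₑ ^ 2) ^ 3 := hgns6
    _ ≤ _ := by gcongr


/-! ### Sobolev thinness of the fast set -/

/-- **THE FAST SET IS SOBOLEV-THIN ON DYADIC SHELLS.**  `V ∈ C¹` with the class growths `∫_{B_L}|V|² ≤ c_A L^{1−2ρ}` and
`∫_{B_L}‖∇V‖² ≤ c_E L^{1−ρ}` (`L > 0`), `ρ ≥ −2`, `a > 0`: for `L ≥ 1`,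
`vol({a‖y‖ ≤ ‖V y‖} ∩ {L ≤ ‖y‖ ≤ 2L}) ≤ K L^{−3−3ρ}` with `K = C_GNS⁶ (2c_E 5^{1−ρ} + 2M²c_A 5^{1−2ρ})³ a⁻⁶`, `C_GNS` Mathlib's `eLpNormLESNormFDerivOfEqInnerConst volume 2` (GNS on `χ_L • V`, then Chebyshev
in `L⁶`: `‖V‖ ≥ aL` on the set). [folklore; GNS inequality] -/
theorem volume_fastSet_inter_shell_le_sobolev {ρ : ℝ} (hρ : -2 ≤ ρ)
    {V : EuclideanSpace ℝ (Fin 3) → EuclideanSpace ℝ (Fin 3)} (hV : ContDiff ℝ 1 V) {cA cE : ℝ} (hcA : 0 ≤ cA) (hcE : 0 ≤ cE)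
    (hA : ∀ L : ℝ, 0 < L → ∫⁻ y in ball (0 : EuclideanSpace ℝ (Fin 3)) L, ‖V y‖ₑ ^ 2 ≤ ENNReal.ofReal (cA * L ^ (1 - 2 * ρ)))
    (hE : ∀ L : ℝ, 0 < L → ∫⁻ y in ball (0 : EuclideanSpace ℝ (Fin 3)) L, ‖fderiv ℝ V y‖ₑ ^ 2 ≤
      ENNReal.ofReal (cE * L ^ (1 - ρ)))
    {a : ℝ} (ha : 0 < a) :
    ∃ K : ℝ, 0 ≤ K ∧ ∀ L : ℝ, 1 ≤ L →
      volume ({y : EuclideanSpace ℝ (Fin 3) | a * ‖y‖ ≤ ‖V y‖} ∩ {y | L ≤ ‖y‖ ∧ ‖y‖ ≤ 2 * L}) ≤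
        ENNReal.ofReal (K * L ^ (-3 - 3 * ρ)) := by
  obtain ⟨M, hM0, hcut⟩ := exists_scaledCutoff
  set K₁ : ℝ := 2 * (cE * 5 ^ (1 - ρ)) + 2 * M ^ 2 * (cA * 5 ^ (1 - 2 * ρ)) with hK₁
  have hK₁0 : 0 ≤ K₁ := by positivity
  set Cr : ℝ := ((eLpNormLESNormFDerivOfEqInnerConst (volume : Measure (EuclideanSpace ℝ (Fin 3))) 2 : ℝ≥0) : ℝ) with hCr
  have hCr0 : 0 ≤ Cr := NNReal.coe_nonneg _
  refine ⟨Cr ^ 6 * K₁ ^ 3 / a ^ 6, by positivity, fun L hL => ?_⟩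
  have hL0 : 0 < L := one_pos.trans_le hL
  obtain ⟨χ, hχ1, hχc, h0, h1, hone, hzero, hdχ⟩ := hcut L hL0
  have h5L : 0 < 5 * L := by positivity
  -- ### the `L⁶` bound
  have hI6 := lintegral_norm_pow_six_le_of_cutoff hV hχ1 hχc h1 h0 hL0 hone hzero hdχ
  have hE' := hE (5 * L) h5L
  have hA' := hA (5 * L) h5L
  set E' : ℝ := cE * (5 * L) ^ (1 - ρ) with hE'def
  set A' : ℝ := cA * (5 * L) ^ (1 - 2 * ρ) with hA'def
  set m2 : ℝ := (M / L) ^ 2 with hm2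
  have hE'0 : 0 ≤ E' := by positivity
  have hA'0 : 0 ≤ A' := by positivity
  have hm20 : 0 ≤ m2 := by positivity
  set X : ℝ := 2 * E' + 2 * m2 * A' with hX
  have hX0 : 0 ≤ X := by positivity
  have hofX : ENNReal.ofReal X = 2 * ENNReal.ofReal E' + 2 * ENNReal.ofReal m2 * ENNReal.ofReal A' := by
    have h2m : (0 : ℝ) ≤ 2 * m2 := by positivity
    rw [hX, ENNReal.ofReal_add (by positivity) (by positivity), ENNReal.ofReal_mul (by norm_num : (0 : ℝ) ≤ 2),
      ENNReal.ofReal_mul h2m, ENNReal.ofReal_mul (by norm_num : (0 : ℝ) ≤ 2), ENNReal.ofReal_ofNat]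
  have hI6' : ∫⁻ y in closedBall (0 : EuclideanSpace ℝ (Fin 3)) (2 * L), ‖V y‖ₑ ^ 6 ≤
      ENNReal.ofReal (Cr ^ 6 * X ^ 3) := by
    refine hI6.trans ?_
    calc (eLpNormLESNormFDerivOfEqInnerConst (volume : Measure (EuclideanSpace ℝ (Fin 3))) 2 : ℝ≥0∞) ^ 6 * ((2 * ∫⁻ y in ball (0 : EuclideanSpace ℝ (Fin 3)) (5 * L), ‖fderiv ℝ V y‖ₑ ^ 2) +
          2 * ENNReal.ofReal ((M / L) ^ 2) * ∫⁻ y in ball (0 : EuclideanSpace ℝ (Fin 3)) (5 * L), ‖V y‖ₑ ^ 2) ^ 3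
        ≤ (eLpNormLESNormFDerivOfEqInnerConst (volume : Measure (EuclideanSpace ℝ (Fin 3))) 2 : ℝ≥0∞) ^ 6 * (2 * ENNReal.ofReal E' + 2 * ENNReal.ofReal m2 * ENNReal.ofReal A') ^ 3 := by gcongr
      _ = ENNReal.ofReal (Cr ^ 6 * X ^ 3) := by
          rw [← hofX, ← ENNReal.ofReal_pow hX0, hCr, ← ENNReal.ofReal_coe_nnreal, ← ENNReal.ofReal_pow (NNReal.coe_nonneg _),
            ← ENNReal.ofReal_mul (by positivity)]
  -- ### `X ≤ K₁ L^{1−ρ}`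
  have hXK : X ≤ K₁ * L ^ (1 - ρ) := by
    have hP : 0 < L ^ (1 - ρ) := Real.rpow_pos_of_pos hL0 _
    have e1 : E' = cE * 5 ^ (1 - ρ) * L ^ (1 - ρ) := by
      rw [hE'def, Real.mul_rpow (by norm_num) hL0.le, mul_assoc]
    have e2 : A' = cA * 5 ^ (1 - 2 * ρ) * L ^ (1 - 2 * ρ) := by
      rw [hA'def, Real.mul_rpow (by norm_num) hL0.le, mul_assoc]
    have hml : m2 * L ^ (1 - 2 * ρ) ≤ M ^ 2 * L ^ (1 - ρ) := by
      have hL2 : m2 = M ^ 2 * L ^ (-2 : ℝ) := by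
        rw [hm2, div_pow, Real.rpow_neg hL0.le, show (L ^ (2 : ℝ)) = L ^ 2 from Real.rpow_two L, div_eq_mul_inv]
      rw [hL2, mul_assoc, ← Real.rpow_add hL0]
      exact mul_le_mul_of_nonneg_left (Real.rpow_le_rpow_of_exponent_le hL (by linarith)) (sq_nonneg _)
    have h5a : 0 ≤ cE * 5 ^ (1 - ρ) := by positivity
    have h5b : 0 ≤ cA * 5 ^ (1 - 2 * ρ) := by positivity
    have key : m2 * A' ≤ M ^ 2 * (cA * 5 ^ (1 - 2 * ρ)) * L ^ (1 - ρ) := by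
      rw [e2, show m2 * (cA * 5 ^ (1 - 2 * ρ) * L ^ (1 - 2 * ρ)) = cA * 5 ^ (1 - 2 * ρ) * (m2 * L ^ (1 - 2 * ρ)) by ring]
      calc cA * 5 ^ (1 - 2 * ρ) * (m2 * L ^ (1 - 2 * ρ)) ≤ cA * 5 ^ (1 - 2 * ρ) * (M ^ 2 * L ^ (1 - ρ)) :=
            mul_le_mul_of_nonneg_left hml h5b
        _ = M ^ 2 * (cA * 5 ^ (1 - 2 * ρ)) * L ^ (1 - ρ) := by ring
    rw [hX, hK₁, e1]
    nlinarith [key]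
  -- ### Chebyshev on the set
  set S : Set (EuclideanSpace ℝ (Fin 3)) := {y | a * ‖y‖ ≤ ‖V y‖} ∩ {y | L ≤ ‖y‖ ∧ ‖y‖ ≤ 2 * L} with hS
  have haL : 0 < (a * L) ^ 6 := by positivity
  have hcheb : ENNReal.ofReal ((a * L) ^ 6) * volume S ≤ ENNReal.ofReal (Cr ^ 6 * X ^ 3) := by
    calc ENNReal.ofReal ((a * L) ^ 6) * volume S = ∫⁻ _ in S, ENNReal.ofReal ((a * L) ^ 6) := (setLIntegral_const S _).symm
      _ ≤ ∫⁻ y in S, ‖V y‖ₑ ^ 6 := by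
          refine lintegral_mono_ae ((ae_restrict_iff' ?_).2 (Eventually.of_forall fun y hy => ?_))
          · exact (isClosed_le (continuous_const.mul continuous_norm) hV.continuous.norm).measurableSet.inter
              ((isClosed_le continuous_const continuous_norm).inter (isClosed_le continuous_norm continuous_const)).measurableSet
          · obtain ⟨hyV, hyL, -⟩ := hy
            rw [← ofReal_norm, ← ENNReal.ofReal_pow (norm_nonneg _)]
            apply ENNReal.ofReal_le_ofReal
            have haL' : a * L ≤ ‖V y‖ := le_trans (mul_le_mul_of_nonneg_left hyL ha.le) hyV
            exact pow_le_pow_left₀ (by positivity) haL' 6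
      _ ≤ ∫⁻ y in closedBall (0 : EuclideanSpace ℝ (Fin 3)) (2 * L), ‖V y‖ₑ ^ 6 := by
          refine lintegral_mono_set fun y hy => ?_
          rw [mem_closedBall, dist_zero_right]
          exact hy.2.2
      _ ≤ ENNReal.ofReal (Cr ^ 6 * X ^ 3) := hI6'
  have hvol : volume S ≤ ENNReal.ofReal (Cr ^ 6 * X ^ 3) / ENNReal.ofReal ((a * L) ^ 6) := by
    rw [ENNReal.le_div_iff_mul_le (Or.inl ((ENNReal.ofReal_pos.2 haL).ne')) (Or.inl ENNReal.ofReal_ne_top), mul_comm]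
    exact hcheb
  refine hvol.trans ?_
  rw [← ENNReal.ofReal_div_of_pos haL]
  apply ENNReal.ofReal_le_ofReal
  -- ### real bookkeeping: `Cr⁶ X³ / (aL)⁶ ≤ (Cr⁶ K₁³ / a⁶) L^{−3−3ρ}`
  have hP : 0 < L ^ (1 - ρ) := Real.rpow_pos_of_pos hL0 _
  have hX3 : X ^ 3 ≤ (K₁ * L ^ (1 - ρ)) ^ 3 := pow_le_pow_left₀ hX0 hXK 3
  have hrpow : (L ^ (1 - ρ)) ^ 3 / L ^ 6 = L ^ (-3 - 3 * ρ) := by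
    rw [← Real.rpow_natCast (L ^ (1 - ρ)) 3, ← Real.rpow_mul hL0.le, ← Real.rpow_natCast L 6,
      ← Real.rpow_sub hL0]
    norm_num
    ring_nf
  calc Cr ^ 6 * X ^ 3 / (a * L) ^ 6 ≤ Cr ^ 6 * (K₁ * L ^ (1 - ρ)) ^ 3 / (a * L) ^ 6 := by
        gcongr
    _ = Cr ^ 6 * K₁ ^ 3 / a ^ 6 * ((L ^ (1 - ρ)) ^ 3 / L ^ 6) := by
        rw [mul_pow, mul_pow]; ring
    _ = Cr ^ 6 * K₁ ^ 3 / a ^ 6 * L ^ (-3 - 3 * ρ) := by rw [hrpow]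

/-- **Dyadic tail.**  If a set `Θ` has `vol(Θ ∩ {L ≤ ‖y‖ ≤ 2L}) ≤ C′ L^s` for `L ≥ L₀ > 0` with `s < 0`, then
`vol(Θ ∩ {R ≤ ‖y‖}) ≤ |C′|(1 − 2^s)⁻¹ R^s` for `R ≥ L₀` (cover by the shells `2^k R ≤ ‖y‖ ≤ 2^{k+1}R`; adapted from
`BernoulliThinness.volume_bernoulliHigh_inter_far_le`). [folklore] -/
theorem volume_inter_far_le_of_shell (Θ : Set (EuclideanSpace ℝ (Fin 3))) {C' L₀ s : ℝ} (hL₀ : 0 < L₀) (hs : s < 0)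
    (hshell : ∀ L : ℝ, L₀ ≤ L → volume (Θ ∩ {y | L ≤ ‖y‖ ∧ ‖y‖ ≤ 2 * L}) ≤ ENNReal.ofReal (C' * L ^ s))
    {R : ℝ} (hR : L₀ ≤ R) :
    volume (Θ ∩ {y | R ≤ ‖y‖}) ≤ ENNReal.ofReal (|C'| * (1 - (2 : ℝ) ^ s)⁻¹ * R ^ s) := by
  -- adapted from `BernoulliThinness.volume_bernoulliHigh_inter_far_le` (…SelfSimilarBernoulliThinness, ns-sz-p1 g4)
  have hRpos : 0 < R := lt_of_lt_of_le hL₀ hR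
  set Sh : ℕ → Set (EuclideanSpace ℝ (Fin 3)) :=
    fun k => Θ ∩ {y | 2 ^ k * R ≤ ‖y‖ ∧ ‖y‖ ≤ 2 * (2 ^ k * R)} with hSh
  have hcover : Θ ∩ {y | R ≤ ‖y‖} ⊆ ⋃ k : ℕ, Sh k := by
    rintro y ⟨hy, hyR⟩
    have h1 : 1 ≤ ‖y‖ / R := by rw [le_div_iff₀ hRpos]; simpa using hyR
    obtain ⟨k, hk1, hk2⟩ := exists_nat_pow_near h1 one_lt_two
    refine mem_iUnion.mpr ⟨k, hy, ?_, ?_⟩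
    · have := (le_div_iff₀ hRpos).mp hk1
      linarith
    · have := (div_lt_iff₀ hRpos).mp hk2
      rw [pow_succ] at this
      linarith
  have hSk : ∀ k : ℕ, volume (Sh k) ≤ ENNReal.ofReal (C' * (2 ^ k * R) ^ s) := fun k =>
    hshell _ (hR.trans (le_mul_of_one_le_left hRpos.le (one_le_pow₀ one_le_two)))
  calc volume (Θ ∩ {y | R ≤ ‖y‖}) ≤ volume (⋃ k : ℕ, Sh k) := measure_mono hcover
    _ ≤ ∑' k : ℕ, volume (Sh k) := measure_iUnion_le _
    _ ≤ ∑' k : ℕ, ENNReal.ofReal (C' * (2 ^ k * R) ^ s) := ENNReal.tsum_le_tsum hSk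
    _ ≤ ENNReal.ofReal (|C'| * (1 - (2 : ℝ) ^ s)⁻¹ * R ^ s) :=
        BernoulliThinness.tsum_ofReal_mul_two_pow_mul_rpow_le C' hRpos hs

/-- **THE FAST SET IS SOBOLEV-THIN FAR OUT**: under the hypotheses of `volume_fastSet_inter_shell_le_sobolev` and `ρ > −1`, there is `K′ ≥ 0` with
`vol({a‖y‖ ≤ ‖V y‖} ∩ {R ≤ ‖y‖}) ≤ K′ R^{−3−3ρ}` for all `R ≥ 1` — thinness rate `m = 3+3ρ` for the (C2) volume squeeze. [folklore; GNS inequality] -/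
theorem volume_fastSet_inter_far_le_sobolev {ρ : ℝ} (hρ : -1 < ρ)
    {V : EuclideanSpace ℝ (Fin 3) → EuclideanSpace ℝ (Fin 3)} (hV : ContDiff ℝ 1 V) {cA cE : ℝ} (hcA : 0 ≤ cA) (hcE : 0 ≤ cE)
    (hA : ∀ L : ℝ, 0 < L → ∫⁻ y in ball (0 : EuclideanSpace ℝ (Fin 3)) L, ‖V y‖ₑ ^ 2 ≤ ENNReal.ofReal (cA * L ^ (1 - 2 * ρ)))
    (hE : ∀ L : ℝ, 0 < L → ∫⁻ y in ball (0 : EuclideanSpace ℝ (Fin 3)) L, ‖fderiv ℝ V y‖ₑ ^ 2 ≤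
      ENNReal.ofReal (cE * L ^ (1 - ρ)))
    {a : ℝ} (ha : 0 < a) :
    ∃ K' : ℝ, 0 ≤ K' ∧ ∀ R : ℝ, 1 ≤ R →
      volume ({y : EuclideanSpace ℝ (Fin 3) | a * ‖y‖ ≤ ‖V y‖} ∩ {y | R ≤ ‖y‖}) ≤ ENNReal.ofReal (K' * R ^ (-3 - 3 * ρ)) := by
  obtain ⟨K, hK0, hshell⟩ := volume_fastSet_inter_shell_le_sobolev (by linarith) hV hcA hcE hA hE ha
  have hs : (-3 - 3 * ρ : ℝ) < 0 := by linarith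
  refine ⟨|K| * (1 - (2 : ℝ) ^ (-3 - 3 * ρ))⁻¹, ?_, fun R hR => volume_inter_far_le_of_shell _ one_pos hs hshell hR⟩
  have h2s1 : (2 : ℝ) ^ (-3 - 3 * ρ) < 1 := Real.rpow_lt_one_of_one_lt_of_neg (by norm_num) hs
  have : 0 < (1 - (2 : ℝ) ^ (-3 - 3 * ρ))⁻¹ := inv_pos.2 (by linarith)
  positivity

end Summit.NavierStokesRegularity.NavierStokesRegularity.Theorems.PowerGaugeEulerLiouville.Loc
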